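import Summits.BirchSwinnertonDyer.BirchSwinnertonDyer.Theorems.SylvesterTwoHeegnerIndexUpperOnV0

/-!
# Closing the split glue `HeegnerIndexUpperOfPartsHSY` (item stmt-BirchSwinnertonDyer-19582)

Route `SylvesterTwoHeegnerIndex` (K7t), rev 8: the rank-2 crux `HeegnerIndexUpperAtTwoHSYOfFacts`
(item 19476) was split by the planner (g16, J ask (4)) into the two displayed inputs of the landed
`Theorems/SylvesterTwoHeegnerIndexUpperOnV0.lean` (p431798):

* `TwoAdicPairHSY` (item 19580) — verbatim the section binder `hBC` (the cell's 2-adic pair index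
  theorem: `ord₂(#Ш_an(E_p)·#Ш_an(E_{3p²}))` even, product non-zero);
* `UpperOffV0HSY` (item 19581) — verbatim the hypothesis `hoff` (off-`𝒱₀` sharp 2-adic Kolyvagin bound).

The glue item `HeegnerIndexUpperOfPartsHSY := TwoAdicPairHSY → UpperOffV0HSY → HeegnerIndexUpperAtTwoHSYOfFacts`
is closed by name by `SylvesterTwoUpper.upperOfFacts_of_twoAdicPair_of_offV0`. Composition only; credits nothing
beyond the landed file. File with
`ledger propose --kind proof --target Summits/BirchSwinnertonDyer/BirchSwinnertonDyer/Theorems/SylvesterTwoHeegnerIndexUpperOfPartsHSY.lean --workitem stmt-BirchSwinnertonDyer-19582`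
once the farm has route rev ≥ 8 (decls `TwoAdicPairHSY`, `UpperOffV0HSY`, `HeegnerIndexUpperOfPartsHSY`).
-/

namespace Summit.BirchSwinnertonDyer.BirchSwinnertonDyer.Theorems.SylvesterTwoUpperOfParts

open Summit.BirchSwinnertonDyer.BirchSwinnertonDyer.Theses.SylvesterTwoHeegnerIndex

/-- **`HeegnerIndexUpperOfPartsHSY` holds** (item stmt-BirchSwinnertonDyer-19582): the split glue of the K7t UPPER twin — `TwoAdicPairHSY → UpperOffV0HSY → HeegnerIndexUpperAtTwoHSYOfFacts` — by name, by `SylvesterTwoUpper.upperOfFacts_of_twoAdicPair_of_offV0` (p431798, k7t-c2). Composition only (planner g16 draft, filed by idle hand k7r-c3). [folklore] -/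
theorem sylvesterTwoHeegnerIndex_heegnerIndexUpperOfPartsHSY : HeegnerIndexUpperOfPartsHSY :=
  fun h₁ h₂ =>
    Summit.BirchSwinnertonDyer.BirchSwinnertonDyer.Theorems.SylvesterTwoUpper.upperOfFacts_of_twoAdicPair_of_offV0
      h₁ h₂

end Summit.BirchSwinnertonDyer.BirchSwinnertonDyer.Theorems.SylvesterTwoUpperOfParts
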